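import Summits.QuantumFields.BalabanUV.Beta.EriceRemainderEnclosureHistoryAutonomyComparisonAgeCompositionLevelGauge
import Summits.QuantumFields.BalabanUV.Beta.EriceRemainderEnclosureHistoryAutonomyComparisonAgeCompositionBVStability

/-!
# EriceRemainderEnclosureHistoryAutonomyComparisonAgeCompositionLevelGaugeEnd — (E116e) route (N), first order: THE EVERY-RANGE END IN OPERATOR FORM — the
# zero-tailed solution operator `S` of EVERY admissible undamped sub-profile (isotone memory `B` with floor `b > 0` dominating `Σ_k L_k·u_k` on the ages `< K`,
# `L ≥ 0`, box solution `h`, any finite set `O` of loaded ages, tail-sum kernel `Σ_{k∈O}[l<k]·L_kh(m+k)³∕2`, any horizon `N ≥ K`) is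
# (i) IN `[0,1]` ON EVERY TRUNCATED INDICATOR, with the level floor: `h(J)²∕h(n)² ≤ S 1_{[0,J]} n ≤ 1` for `n ≤ J ≤ N` (**`flow_indicator_sol_bounds`** —
# (E116d) `flow_nonneg_every_range` ∕ `flow_sol_ge_level_ratio` read through the operator);
# (ii) POSITIVE AND CONTRACTING ON THE CONE OF NON-INCREASING EXCESSES: `0 ≤ S e ≤ e` at every depth for every zero-tailed, non-negative, non-increasing `e`
# (**`flow_sol_nonneg_of_antitone`** — (E115a) `sol_ge_var` ∕ `sol_le_posVar` over (i): the extreme rays of the cone are the truncated indicators);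
# (iii) BV-STABLE ON ARBITRARY INPUTS: `|S f n| ≤ Σ_{n≤J≤N} |f J − f (J+1)|` (**`flow_abs_sol_le_var`** — (E115a) `abs_sol_le_var` over (i)).
# (ii) is THE STEP of the comparison column at first order for the undamped model (conjecture (E58′), route (N), README `HOME/b2b-balaban-beta-d4-p2/g62/e71/
# README.md`): for EVERY admissible profile and EVERY admissible excess the first-order drop never exceeds the excess.  README `HOME/b2b-balaban-beta-d4-p2/g97/
# README.md`.

Cell `pub-balaban`, β-function sub-cell, BINDER row D4 «RemainderConst leaves for Bałaban's split» (`HOME/BINDER-OWNERS.md`; owner lineage `b2b-balaban-beta-an4`;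
this file by co-owner #2 lineage `b2b-balaban-beta-d4-p2`, generation 97), β-FLOW TEAM duty (1), FREEZE (0) honoured (def-free; imports (E116d) `…LevelGauge` and
(E115a) `…BVStability`; uses (E116d) `flow_nonneg_every_range` ∕ `flow_sol_ge_level_ratio`, (E115a) `sol_ge_var` ∕ `sol_le_posVar` ∕ `abs_sol_le_var`, (E115d)
`telescope_Ico` BY NAME; nothing restated).

HONEST FRAMING (page 1, verbatim and binding).  *"Discharging BetaPertH makes Bałaban's UV stability UNCONDITIONAL — a real constructive-QFT result; it is
NOT the continuum limit and NOT the Clay problem."*  THIS FILE DISCHARGES NOTHING OF THE KIND.  Elementary real analysis about ABSTRACT functionals on a box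
]0,γ]^ℕ with displayed floors, profiles and signs, and the FIRST-ORDER, UNDAMPED renewal objects of route (N) built from them — hypotheses of a census, not
facts; the form, signs, ages and moments of Bałaban's (1.22) limit functional are NOT PRINTED ([I] p. 298; GAPS G-t4-U2-1∕-2) and NOT asserted.  Row D4
class UNCHANGED (critical-path width 0; instance 0∕1; D4 DISCHARGE NO DATE).  HONEST DEPENDENCY: continuum YM on T⁴ ⇐ BetaPertH ∧ nine spine estimates
(0/9 proved); BetaPertH ⇐ (D1) ∧ (D4) ∧ CAP+tail; G-an2-4 gates asym, D1 and NE2/3/4.  NOT settled here: the DAMPED first-order system (pin damping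
`Π g_i`); the nonlinear step; anything printed — NOT B12 Thm 2, NOT BetaPertH, NOT continuum, NOT Clay.

WHAT IS PROVED ([folklore]; 0 `def`, 0 sorry).  **`flow_indicator_sol_bounds`**, **`flow_sol_nonneg_of_antitone`**, **`flow_abs_sol_le_var`**; Appendix (gen 97 PS):
**`flow_sol_ge_level_stieltjes`** (`S e(m) ≥ Σ_{J≥m} (e_J − e_{J+1})·a_m∕a_J` for every non-increasing excess — the quantitative END).
-/
noncomputable section
open Finset

namespace Summit.QuantumFields.BalabanUV.Beta.EriceRemainderEnclosureHistoryAutonomyComparisonAgeCompositionLevelGaugeEnd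

open Literature.MathematicalPhysics.QuantumFieldTheory.Balaban1983to89
open Literature.MathematicalPhysics.QuantumFieldTheory.Balaban1983to89.T4BetaStationary
open Literature.MathematicalPhysics.QuantumFieldTheory.Balaban1983to89.T4BetaFlowWellPosed
open Summit.QuantumFields.BalabanUV.Beta.EriceRemainderEnclosureHistoryAutonomyComparisonAgeCompositionBVStability
  (sol_ge_var sol_le_posVar abs_sol_le_var sol_eq_sum_Ico)
open Summit.QuantumFields.BalabanUV.Beta.EriceRemainderEnclosureHistoryAutonomyComparisonAgeCompositionReadVariation (telescope_Ico)
open Summit.QuantumFields.BalabanUV.Beta.EriceRemainderEnclosureHistoryAutonomyComparisonAgeCompositionLevelGauge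
  (flow_nonneg_every_range flow_sol_ge_level_ratio)

variable {B : (ℕ → ℝ) → ℝ} {γ b gIR : ℝ} {L : ℕ → ℝ} {K : ℕ} {h : ℕ → ℝ}

/-- **EVERY TRUNCATED INDICATOR IS SOLVED IN `[0,1]`, WITH THE LEVEL FLOOR.**  For the zero-tailed solution operator `S` of an admissible undamped sub-profile on
the horizon `N ≥ K`, `N ≥ 1`: for every `J ≤ N` and every depth `n`, `0 ≤ S 1_{[0,J]} n ≤ 1`, and `h(J)²∕h(n)² ≤ S 1_{[0,J]} n` when `n ≤ J`. [folklore] -/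
theorem flow_indicator_sol_bounds (hmono : ∀ u v : ℕ → ℝ, SeqBox γ u → SeqBox γ v → (∀ j, u j ≤ v j) → B u ≤ B v)
    (hL : ∀ k, 0 ≤ L k) (hb : 0 < b) (hlo : ∀ u, SeqBox γ u → b ≤ B u) (hdom : ∀ u, SeqBox γ u → ∑ k ∈ range K, L k * u k ≤ B u)
    (hh : SeqBox γ h) (hf : MemFlow B gIR h) (O : Finset ℕ)
    {wO : ℕ → ℕ → ℝ} (hwO : ∀ k m, wO k m = if k ∈ O then L k * h (m + k) ^ 3 / 2 else 0)
    {N : ℕ} (hN : 1 ≤ N) (hKN : K ≤ N) {KO : ℕ → ℕ → ℝ} (hKO : ∀ m l, KO m l = ∑ k ∈ Ico (l + 1) K, wO k m)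
    {R S : (ℕ → ℝ) → ℕ → ℝ} (hR : ∀ u m, R u m = ∑ l ∈ range N, KO m l * u (m + 1 + l))
    (hS : ∀ w : ℕ → ℝ, (∀ n, N < n → w n = 0) → (∀ n, N < n → S w n = 0) ∧ ∀ n, S w n = w n - R (S w) n)
    {J : ℕ} (hJN : J ≤ N) (n : ℕ) :
    (0 ≤ S (fun m => if m ≤ J then (1 : ℝ) else 0) n ∧ S (fun m => if m ≤ J then (1 : ℝ) else 0) n ≤ 1) ∧
      (n ≤ J → h J ^ 2 / h n ^ 2 ≤ S (fun m => if m ≤ J then (1 : ℝ) else 0) n) := by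
  have het : ∀ m, N < m → (fun m => if m ≤ J then (1 : ℝ) else 0) m = 0 := fun m hm => if_neg (show ¬ m ≤ J by omega)
  obtain ⟨hεt, hεrec⟩ := hS _ het
  exact ⟨flow_nonneg_every_range hmono hL hb hlo hdom hh hf O hwO hN hKN hKO hR hJN hεt hεrec n,
    fun hnJ => flow_sol_ge_level_ratio hmono hL hb hlo hdom hh hf O hwO hN hKN hKO hR hJN hεt hεrec n hnJ⟩

/-- **THE STEP AT FIRST ORDER FOR EVERY ADMISSIBLE EXCESS (undamped): `0 ≤ S e ≤ e`.**  Same operator; `e` zero-tailed beyond `N`, non-negative and non-increasing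
in the depth.  Then `0 ≤ S e n ≤ e n` at every depth: the first-order drop is non-negative and never exceeds the excess — for EVERY admissible flow and
sub-profile, at EVERY range.  ((E115a) `sol_ge_var` with the floor `0` and `sol_le_posVar`, over `flow_indicator_sol_bounds`; the positive variation of a
non-increasing excess below `n` telescopes to `e n`.) [folklore] -/
theorem flow_sol_nonneg_of_antitone (hmono : ∀ u v : ℕ → ℝ, SeqBox γ u → SeqBox γ v → (∀ j, u j ≤ v j) → B u ≤ B v)
    (hL : ∀ k, 0 ≤ L k) (hb : 0 < b) (hlo : ∀ u, SeqBox γ u → b ≤ B u) (hdom : ∀ u, SeqBox γ u → ∑ k ∈ range K, L k * u k ≤ B u)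
    (hh : SeqBox γ h) (hf : MemFlow B gIR h) (O : Finset ℕ)
    {wO : ℕ → ℕ → ℝ} (hwO : ∀ k m, wO k m = if k ∈ O then L k * h (m + k) ^ 3 / 2 else 0)
    {N : ℕ} (hN : 1 ≤ N) (hKN : K ≤ N) {KO : ℕ → ℕ → ℝ} (hKO : ∀ m l, KO m l = ∑ k ∈ Ico (l + 1) K, wO k m)
    {R S : (ℕ → ℝ) → ℕ → ℝ} (hR : ∀ u m, R u m = ∑ l ∈ range N, KO m l * u (m + 1 + l))
    (hS : ∀ w : ℕ → ℝ, (∀ n, N < n → w n = 0) → (∀ n, N < n → S w n = 0) ∧ ∀ n, S w n = w n - R (S w) n)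
    {e : ℕ → ℝ} (het : ∀ n, N < n → e n = 0) (he0 : ∀ n, 0 ≤ e n) (hea : ∀ n, e (n + 1) ≤ e n) (n : ℕ) :
    0 ≤ S e n ∧ S e n ≤ e n := by
  have hEND : ∀ J n, J ≤ N → 0 ≤ S (fun m => if m ≤ J then (1 : ℝ) else 0) n ∧ S (fun m => if m ≤ J then (1 : ℝ) else 0) n ≤ 1 :=
    fun J n hJN => (flow_indicator_sol_bounds hmono hL hb hlo hdom hh hf O hwO hN hKN hKO hR hS hJN n).1
  have hsteps : ∀ J, 0 ≤ e J - e (J + 1) := fun J => by linarith [hea J]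
  constructor
  · have h := sol_ge_var hR hS hEND het (n := n) (u := 0) (fun J _ hJN => (hEND J n hJN).1)
    rw [zero_mul, zero_add] at h
    refine le_trans (sum_nonneg fun J _ => ?_) h
    rw [min_eq_right (hsteps J)]
  · have h := sol_le_posVar hR hS hEND het n
    refine h.trans ?_
    have hmax : ∀ J ∈ Ico n (N + 1), max (e J - e (J + 1)) 0 = e J - e (J + 1) := fun J _ => max_eq_left (hsteps J)
    rw [sum_congr rfl hmax]
    by_cases hn : n ≤ N + 1
    · rw [telescope_Ico e N n hn, het (N + 1) (by omega), sub_zero]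
    · rw [Ico_eq_empty (by omega), sum_empty]; exact he0 n

/-- **BV-STABILITY OF EVERY ADMISSIBLE UNDAMPED PROFILE.**  Same operator; ANY zero-tailed input `f`: `|S f n| ≤ Σ_{n≤J≤N} |f J − f (J+1)|`.  ((E115a)
`abs_sol_le_var` over `flow_indicator_sol_bounds`.) [folklore] -/
theorem flow_abs_sol_le_var (hmono : ∀ u v : ℕ → ℝ, SeqBox γ u → SeqBox γ v → (∀ j, u j ≤ v j) → B u ≤ B v)
    (hL : ∀ k, 0 ≤ L k) (hb : 0 < b) (hlo : ∀ u, SeqBox γ u → b ≤ B u) (hdom : ∀ u, SeqBox γ u → ∑ k ∈ range K, L k * u k ≤ B u)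
    (hh : SeqBox γ h) (hf : MemFlow B gIR h) (O : Finset ℕ)
    {wO : ℕ → ℕ → ℝ} (hwO : ∀ k m, wO k m = if k ∈ O then L k * h (m + k) ^ 3 / 2 else 0)
    {N : ℕ} (hN : 1 ≤ N) (hKN : K ≤ N) {KO : ℕ → ℕ → ℝ} (hKO : ∀ m l, KO m l = ∑ k ∈ Ico (l + 1) K, wO k m)
    {R S : (ℕ → ℝ) → ℕ → ℝ} (hR : ∀ u m, R u m = ∑ l ∈ range N, KO m l * u (m + 1 + l))
    (hS : ∀ w : ℕ → ℝ, (∀ n, N < n → w n = 0) → (∀ n, N < n → S w n = 0) ∧ ∀ n, S w n = w n - R (S w) n)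
    {f : ℕ → ℝ} (hft : ∀ n, N < n → f n = 0) (n : ℕ) :
    |S f n| ≤ ∑ J ∈ Ico n (N + 1), |f J - f (J + 1)| :=
  abs_sol_le_var hR hS (fun _ n hJN => (flow_indicator_sol_bounds hmono hL hb hlo hdom hh hf O hwO hN hKN hKO hR hS hJN n).1) hft n

/-! ## Appendix (gen 97 PS): the quantitative END for a general excess -/

/-- **THE LEVEL-STIELTJES LOWER BOUND FOR A GENERAL EXCESS.**  Same operator; `e` zero-tailed beyond `N` and non-increasing in the depth.  Then at every depth
`m`:  `Σ_{m≤J≤N} (e J − e (J+1))·h(J)²∕h(m)² ≤ S e m` — i.e. `S e(m) ≥ a_m·Σ_{J≥m} (e_J − e_{J+1})∕a_J`: the first-order drop is at most `e(m) −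
a_m·Σ_J Δe_J∕a_J = a_m·Σ_{J>m} e_J·(1∕a_{J−1} − 1∕a_J)`, a level-weighted tail of the excess.  ((E115a) `sol_eq_sum_Ico` + `flow_indicator_sol_bounds`; the margin a
nonlinear (perturbative) step would have to absorb — README g97 §4.) [folklore] -/
theorem flow_sol_ge_level_stieltjes (hmono : ∀ u v : ℕ → ℝ, SeqBox γ u → SeqBox γ v → (∀ j, u j ≤ v j) → B u ≤ B v)
    (hL : ∀ k, 0 ≤ L k) (hb : 0 < b) (hlo : ∀ u, SeqBox γ u → b ≤ B u) (hdom : ∀ u, SeqBox γ u → ∑ k ∈ range K, L k * u k ≤ B u)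
    (hh : SeqBox γ h) (hf : MemFlow B gIR h) (O : Finset ℕ)
    {wO : ℕ → ℕ → ℝ} (hwO : ∀ k m, wO k m = if k ∈ O then L k * h (m + k) ^ 3 / 2 else 0)
    {N : ℕ} (hN : 1 ≤ N) (hKN : K ≤ N) {KO : ℕ → ℕ → ℝ} (hKO : ∀ m l, KO m l = ∑ k ∈ Ico (l + 1) K, wO k m)
    {R S : (ℕ → ℝ) → ℕ → ℝ} (hR : ∀ u m, R u m = ∑ l ∈ range N, KO m l * u (m + 1 + l))
    (hS : ∀ w : ℕ → ℝ, (∀ n, N < n → w n = 0) → (∀ n, N < n → S w n = 0) ∧ ∀ n, S w n = w n - R (S w) n)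
    {e : ℕ → ℝ} (het : ∀ n, N < n → e n = 0) (hea : ∀ n, e (n + 1) ≤ e n) (m : ℕ) :
    ∑ J ∈ Ico m (N + 1), (e J - e (J + 1)) * (h J ^ 2 / h m ^ 2) ≤ S e m := by
  have hsteps : ∀ J, 0 ≤ e J - e (J + 1) := fun J => by linarith [hea J]
  by_cases hm : m ≤ N + 1
  · rw [sol_eq_sum_Ico hR hS het hm]
    refine sum_le_sum fun J hJ => mul_le_mul_of_nonneg_left ?_ (hsteps J)
    have hJN : J ≤ N := by have := (mem_Ico.mp hJ).2; omega
    exact (flow_indicator_sol_bounds hmono hL hb hlo hdom hh hf O hwO hN hKN hKO hR hS hJN m).2 (mem_Ico.mp hJ).1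
  · rw [Ico_eq_empty (by omega), sum_empty, (hS e het).1 m (by omega)]

end Summit.QuantumFields.BalabanUV.Beta.EriceRemainderEnclosureHistoryAutonomyComparisonAgeCompositionLevelGaugeEnd

end
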